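import Literature.NumberTheory.LFunctions.ExceptionalPrimesAbel
import Literature.NumberTheory.Sieve.LargeSieveCharacters
import Mathlib.Analysis.SpecialFunctions.Log.Deriv
import HarnessLib

/-!
# Tails of `∑ χ(n)/n = L(1, χ)` and `∑ χ(n) log n/n = −L'(1, χ)` with Pólya–Vinogradov strength

Topic `Literature/NumberTheory/LFunctions`. Everything in this file is PROVED (theorems only).

For a primitive character `χ` modulo `q ≥ 2` the window sums satisfy
`|∑_{N < n ≤ M} χ(n)| ≤ W_q := √q (1 + log q)` (Pólya–Vinogradov; the tree's
`Literature.NumberTheory.Sieve.LargeSieve.polyaVinogradov`). Running the finite Abel summation of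
`Literature/NumberTheory/LFunctions/ExceptionalPrimesAbel.lean` with an arbitrary window bound
`W` in place of `2q` we prove:

* `norm_window_le_polyaVinogradov` — the window bound above;
* `norm_sum_Ioc_mul_le_of_window` — `‖∑_{N<n≤M} χ(n) a(n)‖ ≤ W a(N+1)` for `a ≥ 0` non-increasing
  beyond `N`;
* `norm_sum_Icc_div_sub_LFunction_one_le` — `‖∑_{n ≤ N} χ(n)/n − L(1, χ)‖ ≤ W/(N+1)`;
* `hasSum_deriv_term_one`, `deriv_term_one`, `tendsto_sum_Icc_mul_log_div` — the Abel transform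
  of `L(s, χ)` (`Literature.NumberTheory.LFunctions.DirichletAbel.abelSum`) may be differentiated
  termwise at `s = 1` (Weierstrass, Mathlib's `Complex.hasSum_deriv_of_summable_norm`), whence
  `∑_{n ≤ N} χ(n) log n/n → −L'(1, χ)`;
* `norm_sum_Icc_mul_log_div_add_deriv_le` — `‖∑_{n ≤ N} χ(n) log n/n + L'(1, χ)‖ ≤ W log(N+1)/(N+1)`
  for `N ≥ 2` (the weight `log n/n` decreases from `n = 3` on).

These are the tail estimates of the hyperbola-method asymptotic
`∑_{n ≤ x} (1∗χ)(n)/n = L'(1, χ) + (log x + γ) L(1, χ) + O(W_q log x/√(W_q x))`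
(`ZetaMulHarmonicMean.lean`), Montgomery–Vaughan's input of Tao–Teräväinen's Proposition 3.5.

## References

* H. L. Montgomery, R. C. Vaughan, *Multiplicative Number Theory I*, CUP 2007, §1.3 Thm. 1.3,
  §4.3 Thm. 4.8, §9.4 (Pólya–Vinogradov) [MontgomeryVaughan2007].
* T. Tao, J. Teräväinen, *The Hardy–Littlewood–Chowla conjecture in the presence of a Siegel
  zero*, J. London Math. Soc. (2) 106 (2022), §3 [TaoTeravainen2021].
-/

noncomputable section

open Complex Filter Topology Finset Metric
open Literature.NumberTheory.LFunctions.DirichletAbel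

namespace Literature.NumberTheory.LFunctions.CharacterTails

variable {q : ℕ} [NeZero q] (χ : DirichletCharacter ℂ q)

/-! ### The Pólya–Vinogradov window bound -/

/-- A primitive character modulo `q ≥ 2` is non-principal. [folklore] -/
theorem ne_one_of_isPrimitive (hχ : χ.IsPrimitive) (hq : 2 ≤ q) : χ ≠ 1 := by
  intro h
  have h1 : χ.conductor = q := hχ
  rw [h, DirichletCharacter.conductor_one] at h1
  omega

omit [NeZero q] in
/-- **Pólya–Vinogradov window bound**: for `χ` primitive mod `q ≥ 2` and all `N, M`:
`‖∑_{N < n ≤ M} χ(n)‖ ≤ √q (1 + log q)`. [cite: MontgomeryVaughan2007, §9.4 Thm. 9.18] -/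
theorem norm_window_le_polyaVinogradov (hχ : χ.IsPrimitive) (hq : 2 ≤ q) (N M : ℕ) :
    ‖∑ n ∈ Ioc N M, χ (n : ZMod q)‖ ≤ Real.sqrt q * (1 + Real.log q) := by
  rcases le_or_gt N M with h | h
  · obtain ⟨k, rfl⟩ := Nat.exists_eq_add_of_le h
    exact Literature.NumberTheory.Sieve.LargeSieve.polyaVinogradov hq hχ N k
  · rw [Finset.Ioc_eq_empty (by omega), Finset.sum_empty, norm_zero]
    have : 0 ≤ Real.log q := Real.log_natCast_nonneg q
    positivity

/-! ### Finite Abel summation with a window bound `W` -/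

omit [NeZero q] in
/-- **The finite Abel bound with a window bound `W`**: if `‖∑_{N<k≤n} χ(k)‖ ≤ W` for all `n`,
`a(n) ≥ 0` and `a(n+1) ≤ a(n)` for `n > N`, then `‖∑_{N<n≤M} χ(n) a(n)‖ ≤ W a(N+1)`.
[cite: MontgomeryVaughan2007, §1.3 Thm. 1.3] -/
theorem norm_sum_Ioc_mul_le_of_window {W : ℝ} {N : ℕ}
    (hS : ∀ n, ‖∑ k ∈ Ioc N n, χ (k : ZMod q)‖ ≤ W) {a : ℕ → ℝ}
    (ha0 : ∀ n, N < n → 0 ≤ a n) (ha : ∀ n, N < n → a (n + 1) ≤ a n) (M : ℕ) :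
    ‖∑ n ∈ Ioc N M, χ (n : ZMod q) * (a n : ℂ)‖ ≤ W * a (N + 1) := by
  have hW : 0 ≤ W := le_trans (norm_nonneg _) (hS N)
  rcases le_or_gt N M with h | h
  swap
  · rw [Finset.Ioc_eq_empty (by omega), Finset.sum_empty, norm_zero]
    exact mul_nonneg hW (ha0 _ (Nat.lt_succ_self N))
  have htel : ∑ n ∈ Ioc N M, (a n - a (n + 1)) = a (N + 1) - a (M + 1) := by
    clear ha0 ha hS
    induction M, h using Nat.le_induction with
    | base => simp
    | succ M hNM ih => rw [Finset.sum_Ioc_succ_top hNM, ih]; ring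
  have key := SiegelZero.sum_Ioc_mul_eq_abel χ (fun n => (a n : ℂ)) h
  simp only at key
  rw [key]
  have haM : 0 ≤ a (M + 1) := ha0 _ (by omega)
  calc ‖(∑ n ∈ Ioc N M, χ (n : ZMod q)) * (a (M + 1) : ℂ) +
        ∑ n ∈ Ioc N M, (∑ k ∈ Ioc N n, χ (k : ZMod q)) * ((a n : ℂ) - (a (n + 1) : ℂ))‖
      ≤ ‖(∑ n ∈ Ioc N M, χ (n : ZMod q)) * (a (M + 1) : ℂ)‖ +
        ∑ n ∈ Ioc N M, ‖(∑ k ∈ Ioc N n, χ (k : ZMod q)) * ((a n : ℂ) - (a (n + 1) : ℂ))‖ :=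
          (norm_add_le _ _).trans (by gcongr; exact norm_sum_le _ _)
    _ ≤ W * a (M + 1) + ∑ n ∈ Ioc N M, W * (a n - a (n + 1)) := by
        gcongr with n hn
        · rw [norm_mul, Complex.norm_real, Real.norm_of_nonneg haM]
          exact mul_le_mul_of_nonneg_right (hS M) haM
        · have hn' : N < n := (Finset.mem_Ioc.mp hn).1
          have hd : 0 ≤ a n - a (n + 1) := sub_nonneg.mpr (ha n hn')
          rw [norm_mul, ← Complex.ofReal_sub, Complex.norm_real, Real.norm_of_nonneg hd]
          exact mul_le_mul_of_nonneg_right (hS n) hd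
    _ = W * a (N + 1) := by
        rw [← Finset.mul_sum, htel]
        ring

/-! ### The tail of `∑ χ(n)/n` -/

/-- **`‖∑_{n ≤ N} χ(n)/n − L(1, χ)‖ ≤ W/(N+1)`** under the window bound `W` (letting `M → ∞` in
the finite Abel bound; `∑_{n ≤ M} χ(n)/n → L(1, χ)` is the tree's
`Literature.NumberTheory.LFunctions.SiegelZero.tendsto_sum_Icc_mul_cpow`). [cite: MontgomeryVaughan2007, §4.3 Thm. 4.8] -/
theorem norm_sum_Icc_div_sub_LFunction_one_le (hχ : χ ≠ 1) {W : ℝ} {N : ℕ}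
    (hS : ∀ n, ‖∑ k ∈ Ioc N n, χ (k : ZMod q)‖ ≤ W) :
    ‖∑ n ∈ Icc 1 N, χ (n : ZMod q) / n - χ.LFunction 1‖ ≤ W / ((N : ℝ) + 1) := by
  set P : ℕ → ℂ := fun M => ∑ n ∈ Icc 1 M, χ (n : ZMod q) / n with hP
  -- `P(M) → L(1, χ)`
  have hlim : Tendsto P atTop (𝓝 (χ.LFunction 1)) := by
    have h := SiegelZero.tendsto_sum_Icc_mul_cpow χ hχ (s := 1) (by simp)
    refine h.congr fun M => Finset.sum_congr rfl fun n _ => ?_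
    rw [Complex.cpow_neg_one, div_eq_mul_inv]
  -- the windows
  have hwin : ∀ M, N ≤ M → ‖P M - P N‖ ≤ W / ((N : ℝ) + 1) := by
    intro M hNM
    have hsplit : P M - P N = ∑ n ∈ Ioc N M, χ (n : ZMod q) * (((1 : ℝ) / n : ℝ) : ℂ) := by
      have hI : ∀ K : ℕ, Finset.Icc 1 K = Finset.Ioc 0 K := fun K => by
        ext n; simp only [Finset.mem_Icc, Finset.mem_Ioc]; omega
      simp only [hP]
      rw [hI, hI, ← Finset.sum_Ioc_consecutive _ (Nat.zero_le N) hNM, add_sub_cancel_left]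
      refine Finset.sum_congr rfl fun n _ => ?_
      push_cast
      ring
    rw [hsplit]
    have hb := norm_sum_Ioc_mul_le_of_window χ hS (a := fun n : ℕ => (1 : ℝ) / n)
      (fun n _ => by positivity) (fun n hn => ?_) M
    · refine hb.trans (le_of_eq ?_)
      push_cast
      ring
    · have hn0 : (0 : ℝ) < n := by exact_mod_cast (Nat.zero_le N).trans_lt hn
      push_cast
      exact one_div_le_one_div_of_le hn0 (by linarith)
  -- let `M → ∞`
  have h1 : Tendsto (fun M => ‖P M - P N‖) atTop (𝓝 ‖χ.LFunction 1 - P N‖) :=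
    (tendsto_norm.comp (hlim.sub tendsto_const_nhds))
  have h2 := le_of_tendsto h1 (Filter.eventually_atTop.mpr ⟨N, hwin⟩)
  rwa [norm_sub_rev] at h2

/-! ### Termwise differentiation of the Abel transform at `s = 1` -/

/-- The Abel transform may be differentiated termwise at `s = 1`:
`∑_n (d/ds) [S(n+1)((n+1)^{-s} − (n+2)^{-s})]_{s=1} = L'(1, χ)` (Weierstrass `M`-test on the disc
`|s − 1| < 1/2`, where `‖term_n(s)‖ ≤ (3q/2)(n+1)^{-3/2}`; `L = A_χ` near `1` by
`Literature.NumberTheory.LFunctions.DirichletAbel.LFunction_eq_abelSum`). [cite: MontgomeryVaughan2007, §4.3 Thm. 4.8] -/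
theorem hasSum_deriv_term_one (hχ : χ ≠ 1) :
    HasSum (fun n : ℕ => deriv (term χ n) 1) (deriv χ.LFunction 1) := by
  have hU : IsOpen (ball (1 : ℂ) (1 / 2)) := isOpen_ball
  have hbound : ∀ (n : ℕ) (w : ℂ), w ∈ ball (1 : ℂ) (1 / 2) →
      ‖term χ n w‖ ≤ q * (3 / 2) * ((n + 1 : ℕ) : ℝ) ^ (-(1 / 2 : ℝ) - 1) := by
    intro n w hw
    have hw' : ‖w - 1‖ < 1 / 2 := mem_ball_iff_norm.mp hw
    have hre : 1 / 2 < w.re := by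
      have h1 : |(w - 1).re| ≤ ‖w - 1‖ := Complex.abs_re_le_norm _
      have h2 : (w - 1).re = w.re - 1 := by simp
      rw [h2] at h1
      have := neg_abs_le (w.re - 1)
      linarith
    have hnorm : ‖w‖ ≤ 3 / 2 := by
      have := norm_le_norm_add_norm_sub' w 1
      rw [norm_one] at this
      linarith [norm_sub_rev w 1]
    have h1 : (1 : ℝ) ≤ ((n + 1 : ℕ) : ℝ) := by exact_mod_cast Nat.le_add_left 1 n
    calc ‖term χ n w‖ ≤ q * ‖w‖ * ((n + 1 : ℕ) : ℝ) ^ (-w.re - 1) := norm_term_le χ hχ n (by linarith)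
      _ ≤ q * (3 / 2) * ((n + 1 : ℕ) : ℝ) ^ (-(1 / 2 : ℝ) - 1) :=
          mul_le_mul (mul_le_mul_of_nonneg_left hnorm (Nat.cast_nonneg q))
            (Real.rpow_le_rpow_of_exponent_le h1 (by linarith)) (by positivity) (by positivity)
  have h := Complex.hasSum_deriv_of_summable_norm
    (u := fun n : ℕ => q * (3 / 2) * ((n + 1 : ℕ) : ℝ) ^ (-(1 / 2 : ℝ) - 1))
    ((summable_rpow_neg (by norm_num)).mul_left _)
    (fun n => (differentiable_term χ n).differentiableOn) hU hbound
    (mem_ball_self (by norm_num))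
  have heq : deriv (fun w => ∑' n : ℕ, term χ n w) 1 = deriv χ.LFunction 1 := by
    apply Filter.EventuallyEq.deriv_eq
    filter_upwards [isOpen_re_pos.mem_nhds (show (1 : ℂ) ∈ {s : ℂ | 0 < s.re} by simp)] with w hw
    exact (LFunction_eq_abelSum χ hχ hw).symm
  rwa [heq] at h

omit [NeZero q] in
/-- `(d/ds) m^{-s} = −(log m/m)` at `s = 1`, for `m ≥ 1`. [folklore] -/
theorem hasDerivAt_natCast_cpow_neg_one {m : ℕ} (hm : 1 ≤ m) :
    HasDerivAt (fun s : ℂ => ((m : ℕ) : ℂ) ^ (-s)) (-(((Real.log m / m : ℝ)) : ℂ)) 1 := by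
  have hm0 : ((m : ℕ) : ℂ) ≠ 0 := by exact_mod_cast (show m ≠ 0 by omega)
  have h := (hasDerivAt_neg (1 : ℂ)).const_cpow (c := ((m : ℕ) : ℂ)) (Or.inl hm0)
  refine h.congr_deriv ?_
  rw [Complex.cpow_neg_one]
  push_cast
  ring

omit [NeZero q] in
/-- The derivative of the `n`-th Abel term at `s = 1`:
`(d/ds) [S(n+1)((n+1)^{-s} − (n+2)^{-s})]_{s=1} = −S(n+1) (log(n+1)/(n+1) − log(n+2)/(n+2))`.
[folklore] -/
theorem deriv_term_one (n : ℕ) :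
    deriv (term χ n) 1 =
      -(partialSum χ (n + 1) *
        (((Real.log (n + 1 : ℕ) / (n + 1 : ℕ) : ℝ) : ℂ) -
          ((Real.log (n + 1 + 1 : ℕ) / (n + 1 + 1 : ℕ) : ℝ) : ℂ))) := by
  have h1 := hasDerivAt_natCast_cpow_neg_one (m := n + 1) (by omega)
  have h2 := hasDerivAt_natCast_cpow_neg_one (m := n + 1 + 1) (by omega)
  have h : HasDerivAt (term χ n)
      (partialSum χ (n + 1) * (-(((Real.log (n + 1 : ℕ) / (n + 1 : ℕ) : ℝ)) : ℂ) -
        -(((Real.log (n + 1 + 1 : ℕ) / (n + 1 + 1 : ℕ) : ℝ)) : ℂ))) 1 := by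
    have h12 := (h1.sub h2).const_mul (partialSum χ (n + 1))
    refine h12.congr_of_eventuallyEq (Filter.Eventually.of_forall fun s => ?_)
    simp only [term, Pi.sub_apply]
  rw [h.deriv]
  ring

omit [NeZero q] in
/-- Abel summation for the weights `log n/n`:
`∑_{n ≤ K} χ(n) log n/n = S(K) log(K+1)/(K+1) − ∑_{n < K} (d/ds) term_n(1)`. [cite: MontgomeryVaughan2007, §1.3 Thm. 1.3] -/
theorem sum_Icc_mul_log_div_eq (K : ℕ) :
    ∑ n ∈ Icc 1 K, χ (n : ZMod q) * ((Real.log n / n : ℝ) : ℂ) =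
      partialSum χ K * ((Real.log (K + 1 : ℕ) / (K + 1 : ℕ) : ℝ) : ℂ) -
        ∑ n ∈ range K, deriv (term χ n) 1 := by
  induction K with
  | zero => simp [partialSum]
  | succ K ih =>
    rw [Finset.sum_Icc_succ_top (by omega), ih, Finset.sum_range_succ, deriv_term_one,
      partialSum_succ]
    push_cast
    ring

/-- **`∑_{n ≤ K} χ(n) log n/n → −L'(1, χ)`** for `χ ≠ χ₀` (the boundary term
`S(K) log(K+1)/(K+1) → 0` as `|S(K)| ≤ q`). [cite: MontgomeryVaughan2007, §4.3 Thm. 4.8] -/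
theorem tendsto_sum_Icc_mul_log_div (hχ : χ ≠ 1) :
    Tendsto (fun K : ℕ => ∑ n ∈ Icc 1 K, χ (n : ZMod q) * ((Real.log n / n : ℝ) : ℂ)) atTop
      (𝓝 (-deriv χ.LFunction 1)) := by
  simp_rw [sum_Icc_mul_log_div_eq]
  have hB : Tendsto (fun K : ℕ => partialSum χ K * ((Real.log (K + 1 : ℕ) / (K + 1 : ℕ) : ℝ) : ℂ))
      atTop (𝓝 0) := by
    refine squeeze_zero_norm (a := fun K : ℕ => q * (Real.log (K + 1 : ℕ) / (K + 1 : ℕ))) ?_ ?_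
    · intro K
      rw [norm_mul, Complex.norm_real, Real.norm_of_nonneg (by positivity)]
      exact mul_le_mul_of_nonneg_right (norm_partialSum_le χ hχ K) (by positivity)
    · have h1 : Tendsto (fun K : ℕ => ((K + 1 : ℕ) : ℝ)) atTop atTop :=
        tendsto_natCast_atTop_atTop.comp (tendsto_add_atTop_nat 1)
      have h2 : Tendsto (fun x : ℝ => Real.log x / x) atTop (𝓝 0) :=
        Real.isLittleO_log_id_atTop.tendsto_div_nhds_zero
      simpa using (h2.comp h1).const_mul (q : ℝ)
  have hT : Tendsto (fun K => ∑ n ∈ range K, deriv (term χ n) 1) atTop (𝓝 (deriv χ.LFunction 1)) :=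
    (hasSum_deriv_term_one χ hχ).tendsto_sum_nat
  have := hB.sub hT
  rwa [zero_sub] at this

/-- `log n / n` is non-increasing from `n = 3` on: `log(n+1)/(n+1) ≤ log n/n` for `n ≥ 3`
(`n log(1 + 1/n) ≤ 1 ≤ log n`). [folklore] -/
theorem log_div_succ_le {n : ℕ} (hn : 3 ≤ n) :
    Real.log (n + 1 : ℕ) / (n + 1 : ℕ) ≤ Real.log n / n := by
  have hn0 : (0 : ℝ) < n := by exact_mod_cast (show 0 < n by omega)
  have hn3 : (3 : ℝ) ≤ n := by exact_mod_cast hn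
  have hlog3 : 1 ≤ Real.log n := by
    rw [Real.le_log_iff_exp_le hn0]
    exact le_trans (le_of_lt Real.exp_one_lt_d9) (by linarith)
  have hstep : Real.log (n + 1 : ℕ) ≤ Real.log n + 1 / n := by
    have h1 : Real.log ((n : ℝ) + 1) - Real.log n = Real.log (1 + 1 / n) := by
      rw [← Real.log_div (by positivity) hn0.ne']
      congr 1; field_simp
    have h2 : Real.log (1 + 1 / (n : ℝ)) ≤ 1 / n := by
      have := Real.log_le_sub_one_of_pos (show (0 : ℝ) < 1 + 1 / n by positivity)
      linarith
    push_cast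
    linarith
  push_cast
  rw [div_le_div_iff₀ (by positivity) hn0]
  calc Real.log ((n : ℝ) + 1) * n ≤ (Real.log n + 1 / n) * n := by
        have : Real.log ((n : ℝ) + 1) = Real.log (n + 1 : ℕ) := by push_cast; ring
        rw [this]; exact mul_le_mul_of_nonneg_right hstep hn0.le
    _ = Real.log n * n + 1 := by field_simp
    _ ≤ Real.log n * (n + 1) := by nlinarith

/-- **`‖∑_{n ≤ N} χ(n) log n/n + L'(1, χ)‖ ≤ W log(N+1)/(N+1)`** for `N ≥ 2` under the window bound
`W` (finite Abel bound on `(N, M]` with the weights `log n/n`, then `M → ∞`). [cite: MontgomeryVaughan2007, §4.3 Thm. 4.8] -/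
theorem norm_sum_Icc_mul_log_div_add_deriv_le (hχ : χ ≠ 1) {W : ℝ} {N : ℕ} (hN : 2 ≤ N)
    (hS : ∀ n, ‖∑ k ∈ Ioc N n, χ (k : ZMod q)‖ ≤ W) :
    ‖∑ n ∈ Icc 1 N, χ (n : ZMod q) * ((Real.log n / n : ℝ) : ℂ) + deriv χ.LFunction 1‖ ≤
      W * (Real.log (N + 1 : ℕ) / (N + 1 : ℕ)) := by
  set P : ℕ → ℂ := fun M => ∑ n ∈ Icc 1 M, χ (n : ZMod q) * ((Real.log n / n : ℝ) : ℂ) with hP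
  have hlim : Tendsto P atTop (𝓝 (-deriv χ.LFunction 1)) := tendsto_sum_Icc_mul_log_div χ hχ
  have hwin : ∀ M, N ≤ M → ‖P M - P N‖ ≤ W * (Real.log (N + 1 : ℕ) / (N + 1 : ℕ)) := by
    intro M hNM
    have hsplit : P M - P N = ∑ n ∈ Ioc N M, χ (n : ZMod q) * ((Real.log n / n : ℝ) : ℂ) := by
      have hI : ∀ K : ℕ, Finset.Icc 1 K = Finset.Ioc 0 K := fun K => by
        ext n; simp only [Finset.mem_Icc, Finset.mem_Ioc]; omega
      simp only [hP]
      rw [hI, hI, ← Finset.sum_Ioc_consecutive _ (Nat.zero_le N) hNM, add_sub_cancel_left]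
    rw [hsplit]
    have hb := norm_sum_Ioc_mul_le_of_window χ hS (a := fun n : ℕ => Real.log n / n)
      (fun n _ => by
        have : (1 : ℝ) ≤ n ∨ n = 0 := by
          rcases Nat.eq_zero_or_pos n with h | h
          · right; exact_mod_cast h
          · left; exact_mod_cast h
        rcases this with h | h
        · exact div_nonneg (Real.log_nonneg h) (by linarith)
        · simp [h])
      (fun n hn => log_div_succ_le (by omega)) M
    refine hb.trans (le_of_eq ?_)
    push_cast
    ring
  have h1 : Tendsto (fun M => ‖P M - P N‖) atTop (𝓝 ‖-deriv χ.LFunction 1 - P N‖) :=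
    (tendsto_norm.comp (hlim.sub tendsto_const_nhds))
  have h2 := le_of_tendsto h1 (Filter.eventually_atTop.mpr ⟨N, hwin⟩)
  rwa [show -deriv χ.LFunction 1 - P N = -(P N + deriv χ.LFunction 1) by ring, norm_neg] at h2

end Literature.NumberTheory.LFunctions.CharacterTails
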